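import Summits.BirchSwinnertonDyer.BirchSwinnertonDyer.Theorems.TeichmullerTwistDescentWeightExclusionOfThreeFacts
import Summits.BirchSwinnertonDyer.BirchSwinnertonDyer.Theorems.TeichmullerTwistDescentKOfTameTypeCentral
import HarnessLib

/-!
# Route `TeichmullerTwistDescent`, crux K `TwistedPeriodLatticeSaturation` (stmt-BirchSwinnertonDyer-25368):
# (W‴) in FULL from a SIGNED weight statement, and K reduced to five named inputs

Cell `pub/bsd-wall` (D-0145 line route-BirchSwinnertonDyer-TeichmullerTwistDescent, OPEN rev 7), seat `bsd-line-ttd-p1` (prover 1/2,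
g27).  THEOREMS ONLY; `--supports stmt-BirchSwinnertonDyer-25368`.  BSD is not proved by this file; K is NOT proved by this file
(it is proved CONDITIONALLY on five hypotheses); nothing here closes an item.

WHAT.  `TeichmullerTwistDescentWeightExclusionOfThreeFacts` proves (W‴) `NoEtaleWeightEigenQuotient` OFF Kodaira type III from the three
cite-only facts WEIGHT (`fullLevelHomology_twist_isModular_of_eigenMap`, sign-free: `p − 1 ∣ 2(s + c)`), SHAPE (Kraus Prop. 1) and MIN
(Edixhoven Thm. 4.5).  On type III (`4b = p − 1`) the sign-free WEIGHT leaves the branch `s ≡ −b`, of twist shape `(2b + 1, 0)` and Serre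
weight exactly `2b + 2` — no contradiction.  This file isolates the missing input as the SIGNED form of WEIGHT — the same statement with
`p − 1 ∣ s + c` (i.e. `ρ̄_f ≅ ω^{−c} ρ̄_W`; this is what the Eichler–Shimura/Ash–Stevens dictionary gives when the Hecke operator on
`Sym^g ⊗ det^c`-valued classes is `det(β̄ᵢ)^c = q^c` times the one on `Sym^g`, for either of the dual identifications, the weight
`Sym^{2b} ⊗ det^{−b}` being self-dual) — spelled INLINE as the hypothesis `hWt1` (it is not a tree definition; the planner may name it):

* `noEtaleWeightEigenQuotient_typeIII_of_signed_weight` — (W‴) on `ord_pΔ_min = 3` from signed WEIGHT ∧ SHAPE ∧ MIN (twist shape `(1, 2b)`,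
  `k = p + 1 + 2b > 2b + 2`);
* `noEtaleWeightEigenQuotient_of_signed_weight` — (W‴) `NoEtaleWeightEigenQuotient` IN FULL from signed WEIGHT ∧ SHAPE ∧ MIN (types II/IV via
  the three-facts theorem, the signed statement implying the sign-free one);
* `twistedPeriodLatticeSaturation_of_five_inputs` — **K** (`TwistedPeriodLatticeSaturation`, the route decl VERBATIM) from: modularity
  `exists_isNewformOf`, the cite-only tame-type fact `fullLevelHomology_isIsotypic_tamePrincipalSeries_of_central`, signed WEIGHT, Kraus Prop. 1,
  Edixhoven Thm. 4.5.
-/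

set_option autoImplicit false
-- single-conjunct summit: `Summit.BirchSwinnertonDyer.BirchSwinnertonDyer.…` repeats the name by design
set_option linter.dupNamespace false

noncomputable section

open scoped MatrixGroups NumberField Valued
open Function CongruenceSubgroup IsDedekindDomain ValuativeRel
open Literature.RepresentationTheory.FiniteGroups Literature.RepresentationTheory.FiniteGroups.GL2
  Literature.NumberTheory.EllipticCurves.ModularForms
open Literature.NumberTheory.EllipticCurves (Kato2004.teichmullerChar)
open Literature.NumberTheory.ModularSymbols Literature.NumberTheory.ModularSymbols.FullLevel
open Literature.NumberTheory.GaloisRepresentations Literature.NumberTheory.GaloisRepresentations.ModPGaloisRep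
open Literature.NumberTheory.GaloisRepresentations.IsNonarchimedeanLocalField
open Literature.NumberTheory.Automorphic

namespace Summit.BirchSwinnertonDyer.BirchSwinnertonDyer.Theorems.TeichmullerTwistDescent

open WeierstrassCurve Literature.NumberTheory.EllipticCurves Literature.NumberTheory.EllipticCurves.Rank1Residual
open Summit.BirchSwinnertonDyer.BirchSwinnertonDyer.Theses.TeichmullerTwistDescent

namespace WeightExclusion

/-! ### Type III arithmetic -/

/-- Type III: with `4b = p − 1`, `1 ≤ b` and the SIGNED congruence `p − 1 ∣ s + (p − 1 − b)`, the exponents `(p − b + s, b + s)` of the twist are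
`≡ (1, 2b)` mod `p − 1`. [folklore] -/
theorem typeIII_shape_signed {p b s : ℕ} (h4b : 4 * b = p - 1) (hb : 1 ≤ b) (hs : (p - 1) ∣ s + (p - 1 - b)) :
    p - b + s ≡ 1 [MOD p - 1] ∧ b + s ≡ 2 * b [MOD p - 1] := by
  obtain ⟨m, hm⟩ := hs
  have h3b : p - 1 - b = 3 * b := by omega
  rw [h3b] at hm
  have hsr : s + 3 * b ≡ 0 [MOD p - 1] := by
    unfold Nat.ModEq
    rw [hm, Nat.mul_mod_right, Nat.zero_mod]
  refine ⟨?_, ?_⟩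
  · rw [show p - b + s = s + 3 * b + 1 by omega]
    exact hsr.add_right 1
  · refine Nat.ModEq.add_right_cancel' (2 * b) ?_
    rw [show b + s + 2 * b = s + 3 * b by omega, show 2 * b + 2 * b = 0 + (p - 1) by omega]
    exact hsr.trans Nat.add_modEq_right.symm

/-! ### (W‴) on Kodaira type III from the signed weight statement -/

/-- **(W‴) `NoEtaleWeightEigenQuotient` on Kodaira type III (`ord_pΔ_min = 3`, `4b = p − 1`) from SIGNED WEIGHT ∧ SHAPE ∧ MIN.**  The
hypothesis `hWt1` is `fullLevelHomology_twist_isModular_of_eigenMap` with the sharper conclusion `p − 1 ∣ s + c` (spelled inline).  Then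
the twist has normalised shape `(1, 2b)` (`typeIII_shape_signed`), Serre weight `p + 1 + 2b` unconditionally, against Edixhoven's `≤ 2b + 2`.
[cite: BuzzardDiamondJarvis2010, §2 Prop. 2.5, Cor. 2.10] [cite: Kraus1997Dissertationes, Prop. 1] [cite: Edixhoven1992, Thm. 4.5]
[cite: Serre1987, §2.2–2.4] -/
theorem noEtaleWeightEigenQuotient_typeIII_of_signed_weight
    (hWt1 : ∀ (p M : ℕ) [Fact p.Prime] [NeZero M] (E : WeierstrassCurve ℚ) [E.IsElliptic] (g c : ℕ),
      5 ≤ p → Nat.Coprime p M → g + 1 ≤ p → (p - 1) ∣ g + 2 * c → Rank1Residual.Irr E p →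
      (letI : Algebra ℤ_[p] (ZMod p) := (PadicInt.toZMod (p := p)).toAlgebra
       ∃ Θ : H1carrier ℤ_[p] p M →ₗ[ℤ_[p]] ↥(MvPolynomial.homogeneousSubmodule (Fin 2) (ZMod p) g),
         Θ ≠ 0 ∧
         (∀ (h : GL (Fin 2) (ZMod p)) (z : H1carrier ℤ_[p] p M),
            Θ (H1carrierRep ℤ_[p] p M h z) =
              symPowTwist (ZMod.castHom (dvd_refl p) (ZMod p))
                (reduceChar (ZMod p) (Kato2004.teichmullerChar p ^ c)) g h (Θ z)) ∧
         (∀ (q : ℕ) [NeZero q] (hq : q.Prime) (hqp : q ≠ p) (z : H1carrier ℤ_[p] p M),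
            Θ (heckeT ℤ_[p] p M hq hqp z) = ((E.LFunction q : ℤ) : ZMod p) • Θ z)) →
      ∀ (ρ : ModPGaloisRep ℚ (ZMod p) 2), E.IsTorsionGaloisRep p ρ →
      ∀ (k : Type) [Field k] [TopologicalSpace k] [DiscreteTopology k] [CharP k p] [IsAlgClosed k]
        (j : ZMod p →+* k),
      ∃ (s N : ℕ) (_ : NeZero N) (f : CuspForm (Gamma1 N) ((g : ℤ) + 2)) (ιf : coeffCharIntegers f →+* k),
        (p - 1) ∣ s + c ∧ ¬ p ∣ N ∧ IsNewform1 f ∧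
          IsGaloisRepOfNewform1Int f ιf {q | q ∣ N * p}
            (FramedRep.twist (FramedRep.baseChange j continuous_of_discreteTopology ρ)
              (modPCyclotomicCharacter ℚ k p j ^ s)))
    (hKr : Kraus1997.propOne_inertiaShape_of_ordinary)
    (hEd : edixhoven1992_serreWeight_le_weight_of_newform)
    (p M : ℕ) [Fact p.Prime] [NeZero M] (W : WeierstrassCurve ℚ) [W.IsElliptic] [W.IsGloballyMinimal]
    (hN : W.conductorNorm ℤ = p ^ 2 * M) (hp11 : 11 ≤ p) (hadd : Rank1Residual.Addv W p) (hirr : Rank1Residual.Irr W p)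
    (hGo : Summit.BirchSwinnertonDyer.Rank1Residual.Additive.TypeGOrd W p) (hV4 : padicValInt p W.minimalDiscriminantInt ≤ 4)
    (hIII : padicValInt p W.minimalDiscriminantInt = 3) :
    letI : Algebra ℤ_[p] (ZMod p) := (PadicInt.toZMod (p := p)).toAlgebra
    ∀ Θ : H1carrier ℤ_[p] p M →ₗ[ℤ_[p]] ↥(MvPolynomial.homogeneousSubmodule (Fin 2) (ZMod p) (2 * tameExponent p W)),
    (∀ (g : GL (Fin 2) (ZMod p)) (z : H1carrier ℤ_[p] p M),
        Θ (H1carrierRep ℤ_[p] p M g z) =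
          symPowTwist (ZMod.castHom (dvd_refl p) (ZMod p))
            (reduceChar (ZMod p) (Kato2004.teichmullerChar p ^ (p - 1 - tameExponent p W)))
            (2 * tameExponent p W) g (Θ z)) →
    (∀ (q : ℕ) [NeZero q] (hq : q.Prime) (hqp : q ≠ p) (z : H1carrier ℤ_[p] p M),
        Θ (heckeT ℤ_[p] p M hq hqp z) = (((W.LFunction q : ℤ) : ZMod p)) • Θ z) →
    Θ = 0 := by
  intro Θ hΘG hΘT
  by_contra hΘ0
  have hp : p.Prime := Fact.out
  have hp5 : 5 ≤ p := le_trans (by norm_num) hp11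
  have hp2 : p ≠ 2 := by omega
  have h4b : 4 * tameExponent p W = p - 1 := by
    rcases TameExponent.tameExponent_cases W p hp5 hadd hGo hV4 with ⟨h2, _, _⟩ | ⟨_, _, h⟩ | ⟨h4, _, _⟩
    · omega
    · exact h
    · omega
  have hb2 : 2 ≤ tameExponent p W := TameExponent.two_le_tameExponent W p hp11 hadd hGo hV4
  have hpM : Nat.Coprime p M := coprime_of_conductorNorm_eq_sq_mul W p M hp5 hN
  haveI : NeZero ((p : ℕ) : ℚ) := ⟨by exact_mod_cast hp.ne_zero⟩
  obtain ⟨ρ, hρ⟩ := W.exists_isTorsionGaloisRep p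
  letI : TopologicalSpace (AlgebraicClosure (ZMod p)) := ⊥
  haveI : DiscreteTopology (AlgebraicClosure (ZMod p)) := ⟨rfl⟩
  obtain ⟨s, N, hN0, f, ιf, hsdiv, hpN, hf, hgal⟩ :=
    hWt1 p M W (2 * tameExponent p W) (p - 1 - tameExponent p W) hp5 hpM (by omega) ⟨2, by omega⟩ hirr
      ⟨Θ, hΘ0, hΘG, hΘT⟩ ρ hρ (AlgebraicClosure (ZMod p)) (algebraMap (ZMod p) (AlgebraicClosure (ZMod p)))
  haveI := hN0
  have hPGO : W.HasPotentiallyGoodOrdinaryReductionAtPrime p :=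
    W.hasPotentiallyGoodOrdinaryReductionAtPrime_of_forall_intermediateField p hp hGo
  have hKr' : ∀ (loc : LocalRestrictionAt p (FramedRep.baseChange (algebraMap (ZMod p) (AlgebraicClosure (ZMod p)))
      continuous_of_discreteTopology ρ)) (ι : absIntegers 𝒪[loc.F] loc.F ⧸ absMaximalIdeal loc.F →+* AlgebraicClosure (ZMod p)),
      loc.rep.HasLevelOneInertiaShape ι ((p : ℕ) : 𝒪[loc.F]) loc.irreducible_natCast (p - tameExponent p W) (tameExponent p W) :=
    fun loc ι => hKr p hp5 W hadd hPGO ρ hρ (AlgebraicClosure (ZMod p)) _ continuous_of_discreteTopology loc ι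
  obtain ⟨hβ, hα⟩ := typeIII_shape_signed h4b (by omega) hsdiv
  exact false_of_twist_isModular_of_generic_shape hp2 hEd (W.det_eq_modPCyclotomicCharacter_of_isTorsionGaloisRep_holds p ρ hρ)
    (BCDT.isAbsolutelyIrreducible_of_hasIrreducibleModPGaloisRep W hp2 hirr hρ) _ hKr' hβ hα
    (by omega) (by omega) le_rfl (by omega) (by omega) (by omega) hpN (w := ((2 * tameExponent p W : ℕ) : ℤ) + 2)
    (by omega) (by push_cast; omega) f ιf hf hgal

/-! ### (W‴) in full, and K from five named inputs -/

/-- **(W‴) `NoEtaleWeightEigenQuotient` IN FULL from SIGNED WEIGHT ∧ SHAPE ∧ MIN.**  The signed statement implies the sign-free WEIGHT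
fact (`p − 1 ∣ s + c ⟹ p − 1 ∣ 2(s + c)`), which settles types II and IV (`noEtaleWeightEigenQuotient_of_ne_three_of_three_facts`); type III is
`noEtaleWeightEigenQuotient_typeIII_of_signed_weight`.
[cite: BuzzardDiamondJarvis2010, §2 Prop. 2.5, Cor. 2.10] [cite: Kraus1997Dissertationes, Prop. 1] [cite: Edixhoven1992, Thm. 4.5] -/
theorem noEtaleWeightEigenQuotient_of_signed_weight
    (hWt1 : ∀ (p M : ℕ) [Fact p.Prime] [NeZero M] (E : WeierstrassCurve ℚ) [E.IsElliptic] (g c : ℕ),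
      5 ≤ p → Nat.Coprime p M → g + 1 ≤ p → (p - 1) ∣ g + 2 * c → Rank1Residual.Irr E p →
      (letI : Algebra ℤ_[p] (ZMod p) := (PadicInt.toZMod (p := p)).toAlgebra
       ∃ Θ : H1carrier ℤ_[p] p M →ₗ[ℤ_[p]] ↥(MvPolynomial.homogeneousSubmodule (Fin 2) (ZMod p) g),
         Θ ≠ 0 ∧
         (∀ (h : GL (Fin 2) (ZMod p)) (z : H1carrier ℤ_[p] p M),
            Θ (H1carrierRep ℤ_[p] p M h z) =
              symPowTwist (ZMod.castHom (dvd_refl p) (ZMod p))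
                (reduceChar (ZMod p) (Kato2004.teichmullerChar p ^ c)) g h (Θ z)) ∧
         (∀ (q : ℕ) [NeZero q] (hq : q.Prime) (hqp : q ≠ p) (z : H1carrier ℤ_[p] p M),
            Θ (heckeT ℤ_[p] p M hq hqp z) = ((E.LFunction q : ℤ) : ZMod p) • Θ z)) →
      ∀ (ρ : ModPGaloisRep ℚ (ZMod p) 2), E.IsTorsionGaloisRep p ρ →
      ∀ (k : Type) [Field k] [TopologicalSpace k] [DiscreteTopology k] [CharP k p] [IsAlgClosed k]
        (j : ZMod p →+* k),
      ∃ (s N : ℕ) (_ : NeZero N) (f : CuspForm (Gamma1 N) ((g : ℤ) + 2)) (ιf : coeffCharIntegers f →+* k),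
        (p - 1) ∣ s + c ∧ ¬ p ∣ N ∧ IsNewform1 f ∧
          IsGaloisRepOfNewform1Int f ιf {q | q ∣ N * p}
            (FramedRep.twist (FramedRep.baseChange j continuous_of_discreteTopology ρ)
              (modPCyclotomicCharacter ℚ k p j ^ s)))
    (hKr : Kraus1997.propOne_inertiaShape_of_ordinary)
    (hEd : edixhoven1992_serreWeight_le_weight_of_newform) :
    NoEtaleWeightEigenQuotient := by
  -- the sign-free fact from the signed one
  have hWt : fullLevelHomology_twist_isModular_of_eigenMap := by
    intro p M _ _ E _ g c hp5 hpM hg hdiv hirr hΘ ρ hρ k _ _ _ _ _ j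
    obtain ⟨s, N, hN0, f, ιf, hs, hpN, hf, hgal⟩ := hWt1 p M E g c hp5 hpM hg hdiv hirr hΘ ρ hρ k j
    exact ⟨s, N, hN0, f, ιf, Dvd.dvd.mul_left hs 2, hpN, hf, hgal⟩
  intro p M _ _ W _ _ hN hp11 hadd hirr hGo hV4 Θ hΘG hΘT
  by_cases hIII : padicValInt p W.minimalDiscriminantInt = 3
  · exact noEtaleWeightEigenQuotient_typeIII_of_signed_weight hWt1 hKr hEd p M W hN hp11 hadd hirr hGo hV4 hIII Θ hΘG hΘT
  · exact noEtaleWeightEigenQuotient_of_ne_three_of_three_facts hWt hKr hEd p M W hN hp11 hadd hirr hGo hV4 hIII Θ hΘG hΘT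

/-- **K (`TwistedPeriodLatticeSaturation`, the route decl VERBATIM) from five named inputs**: modularity `exists_isNewformOf` (C13), the
cite-only tame-type fact `fullLevelHomology_isIsotypic_tamePrincipalSeries_of_central` (Conrad–Diamond–Taylor 1999), the SIGNED weight statement
(inline, Buzzard–Diamond–Jarvis 2010 §2 with Ash–Stevens; sign = Hecke normalisation), Kraus 1997 Prop. 1, Edixhoven 1992 Thm. 4.5 — by
`KOfTameType.twistedPeriodLatticeSaturation_of_tameTypeCentral_of_noEtaleWeightEigenQuotient` and `noEtaleWeightEigenQuotient_of_signed_weight`.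
BSD is not proved by this; K is proved CONDITIONALLY (five hypotheses, none of them the crux or a paraphrase of it).
[cite: ConradDiamondTaylor1999, Lemma 4.2.4 (2), §5.3] [cite: BuzzardDiamondJarvis2010, §2 Prop. 2.5, Cor. 2.10]
[cite: Kraus1997Dissertationes, Prop. 1] [cite: Edixhoven1992, Thm. 4.5] -/
theorem twistedPeriodLatticeSaturation_of_five_inputs (hnf : exists_isNewformOf)
    (hT : fullLevelHomology_isIsotypic_tamePrincipalSeries_of_central)
    (hWt1 : ∀ (p M : ℕ) [Fact p.Prime] [NeZero M] (E : WeierstrassCurve ℚ) [E.IsElliptic] (g c : ℕ),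
      5 ≤ p → Nat.Coprime p M → g + 1 ≤ p → (p - 1) ∣ g + 2 * c → Rank1Residual.Irr E p →
      (letI : Algebra ℤ_[p] (ZMod p) := (PadicInt.toZMod (p := p)).toAlgebra
       ∃ Θ : H1carrier ℤ_[p] p M →ₗ[ℤ_[p]] ↥(MvPolynomial.homogeneousSubmodule (Fin 2) (ZMod p) g),
         Θ ≠ 0 ∧
         (∀ (h : GL (Fin 2) (ZMod p)) (z : H1carrier ℤ_[p] p M),
            Θ (H1carrierRep ℤ_[p] p M h z) =
              symPowTwist (ZMod.castHom (dvd_refl p) (ZMod p))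
                (reduceChar (ZMod p) (Kato2004.teichmullerChar p ^ c)) g h (Θ z)) ∧
         (∀ (q : ℕ) [NeZero q] (hq : q.Prime) (hqp : q ≠ p) (z : H1carrier ℤ_[p] p M),
            Θ (heckeT ℤ_[p] p M hq hqp z) = ((E.LFunction q : ℤ) : ZMod p) • Θ z)) →
      ∀ (ρ : ModPGaloisRep ℚ (ZMod p) 2), E.IsTorsionGaloisRep p ρ →
      ∀ (k : Type) [Field k] [TopologicalSpace k] [DiscreteTopology k] [CharP k p] [IsAlgClosed k]
        (j : ZMod p →+* k),
      ∃ (s N : ℕ) (_ : NeZero N) (f : CuspForm (Gamma1 N) ((g : ℤ) + 2)) (ιf : coeffCharIntegers f →+* k),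
        (p - 1) ∣ s + c ∧ ¬ p ∣ N ∧ IsNewform1 f ∧
          IsGaloisRepOfNewform1Int f ιf {q | q ∣ N * p}
            (FramedRep.twist (FramedRep.baseChange j continuous_of_discreteTopology ρ)
              (modPCyclotomicCharacter ℚ k p j ^ s)))
    (hKr : Kraus1997.propOne_inertiaShape_of_ordinary)
    (hEd : edixhoven1992_serreWeight_le_weight_of_newform) :
    Summit.BirchSwinnertonDyer.BirchSwinnertonDyer.Theses.TeichmullerTwistDescent.TwistedPeriodLatticeSaturation :=
  KOfTameType.twistedPeriodLatticeSaturation_of_tameTypeCentral_of_noEtaleWeightEigenQuotient hnf hT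
    (noEtaleWeightEigenQuotient_of_signed_weight hWt1 hKr hEd)

end WeightExclusion

end Summit.BirchSwinnertonDyer.BirchSwinnertonDyer.Theorems.TeichmullerTwistDescent
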